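import Literature.NumberTheory.EllipticCurves.Rank1Residual.Typed.WuthrichUpperBound
import Literature.NumberTheory.EllipticCurves.SupersingularIrreducibleProofs
import HarnessLib

/-!
# Class X7 (supersingular `p`, `E` not semistable) — TYPED missing input (cell `b2b-bsdres`)

HONEST FRAMING (run/shared/lean/b2b/bsd-rank1-residual/): construction-shaped classes are TYPED
(missing input named; required output at `(E,p)` stated), NOT attempted; this is not "finishing BSD".

**Class X7** (RESIDUAL-CASES §a.2 v3; `Rank1Residual.ClassX7 W p := GoodSS W p ∧ ¬ Semistable W`):
`p` a prime of good SUPERSINGULAR reduction for a curve with an additive prime elsewhere; both ranks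
(e.g. `580b1@3`; `8592m1@5`, decided per curve by a Kurihara number). Census v3: 6 pairs with
`N < 2500` (3 of rank `0`, 3 of rank `1`, all at `p = 3`), 40 with `N < 10⁴`. Label:
CONSTRUCTION-SHAPED (medium). By naive height this is the whole supersingular mass (RESIDUAL-CASES
(b-H): density `.665` at `p = 3`, `.160` at `p = 5`).

**What kind of object is missing.** A SIGNED (`±`, Kobayashi–Pollack) Iwasawa main conjecture at
NON-SQUARE-FREE level, together with its control/leading-term bookkeeping: every published or
announced equality in the supersingular case (Burungale–Skinner–Tian–Wan arXiv:2409.01350v2 Thm. 10.1 /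
Cor. 10.2 (p. 86; = chunk-text "Thm. 2.1 / Cor. 2.2" of the held TeX, Part-III counters flattened), PRE; Sprung; Castella–Çiperiani–Skinner–Sprung, PRE) needs `N` square-free for the Heegner /
definite-quaternion side (`N⁻` conditions); a solvable-base-change route would need the supersingular
`p`-part over totally real fields, not in print.

**Closest published results, verbatim, and why they do not reach X7.**
* Burungale–Skinner–Tian–Wan, arXiv:2409.01350v2 (PRE), Thm. 1.5: "`E` semistable, `p > 2`
  supersingular [(1.7) `a_p(E) = 0` if `p = 3`; TeX label (h4)]; if `ord L = r ≤ 1` then the `p`-part of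
  the BSD formula is true" (p. 4)
  — SEMISTABLE `E` only (and unrefereed); Thm. 1.3 covers also quadratic twists `E^K` of semistable
  curves with `disc(K)` divisible only by ordinary primes.
* Jetchev–Skinner–Wan, Camb. J. Math. 5 (2017), Thm. 1.2.1: "Let `E` be a SEMISTABLE elliptic curve
  over `ℚ` …" (rank `1`; its supersingular case moreover imports Wan's unpublished `±`-IMC).
* One-sided, PUBLISHED: Kobayashi, Invent. Math. 152 (2003) (`char X^± ∣ (L_p^±)`, hence in analytic
  rank `0` `ord_p #Ш[p^∞] ≤` analytic side) and, with no semistability hypothesis on `E`, Wuthrich,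
  Doc. Math. 19 (2014), Prop. 21: at an odd prime of good reduction with `ρ̄_{E,p}` surjective or
  reducible and `L(E,1) ≠ 0`, `ord_p #Ш ≤ ord_p #Ш_an` (tree fact `Wuthrich2014.sha_dvd_analyticSha`;
  here `Typed.missingUpperBoundAt_of_wuthrich`). So at an X7 pair of analytic rank `0` with odd `p`
  and surjective-or-Borel image the UPPER half is in print and the missing input is the LOWER bound
  only; per curve C12 (Kato–GJPST) / C15 (Kim's Kurihara-number certificate) / C11 (Heegner index)
  can decide `BSD(E,p)`.

This file: `X7.MissingInputAt` (rank `0`, odd `p`, Borel-or-surjective image: `MissingLowerBoundAt`;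
otherwise the whole `MissingPPartAt`) and the conditional class theorem `X7.bsdp_of_missingInputAt`.
APPEND (harvest seat 1 GEN 8, theorems only): at an X7 pair with `p ≠ 2`, `E[p]` is ALWAYS
irreducible — Serre 1972 §1.11 Prop. 12, the tree THEOREM `hasIrreducibleModPGaloisRep_of_dvd_frobeniusTrace`
(`ClassX7.irr`); so the Borel branch of the rank-`0` proviso is EMPTY (`X7.red_or_surj_iff`) and in
analytic rank `0` at odd `p` the typed input reads "surj(p) → lower bound; ¬surj(p) → whole output"
(`X7.missingInputAt_iff_of_analyticRank_eq_zero`; surjectivity is NOT automatic here — `E` has an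
additive prime, Serre's Prop. 21 needs semistability). No label change.
The class-wide statement is not a Literature statement; recorded in CLASSES.md.
-/

noncomputable section

open scoped Classical

open WeierstrassCurve Literature.NumberTheory.EllipticCurves
  Literature.NumberTheory.EllipticCurves.Rank1Residual
  Literature.NumberTheory.EllipticCurves.Wuthrich2014

namespace Literature.NumberTheory.EllipticCurves.Rank1Residual.Typed

/-- **X7 — the missing input at `(E, p)`, typed**: at a good supersingular prime of a
non-semistable curve the signed (`±`) IMC at non-square-free level with its control is not in print
(BSTW 2409.01350 Thm. 1.5 and JSW 2017 Thm. 1.2.1 need `E` semistable; BSTW is moreover unrefereed).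
In analytic rank `0` at odd `p` with Borel-or-surjective image, Wuthrich 2014 Prop. 21 supplies
`ord_p #Ш ≤ ord_p #Ш_an`, so the missing input is the LOWER bound `MissingLowerBoundAt`; in every
other case it is the whole output `MissingPPartAt`. Nothing asserted. [cite: BurungaleSkinnerTianWan2024, Thm. 1.5 (hypothesis: E semistable) (shape only; nothing asserted)] [cite: Wuthrich2014, Prop. 21 (p. 400) (shape only; nothing asserted)] -/
def X7.MissingInputAt (W : WeierstrassCurve ℚ) (p : ℕ) [Fact p.Prime] : Prop :=
  (W.analyticRank = 0 → p ≠ 2 → (Red W p ∨ Surj W p) → MissingLowerBoundAt W p) ∧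
  (¬ (W.analyticRank = 0 ∧ p ≠ 2 ∧ (Red W p ∨ Surj W p)) → MissingPPartAt W p)

/-- **X7 conditional class theorem**: in analytic rank `≤ 1`, the typed missing input at an X7 pair
yields Miller's `BSD(E,p)`; the rank-`0` published half is Wuthrich's Prop. 21 (`hW`; good
reduction at `p` ⇒ not additive). Standing named facts: GZK `hGZK`, modularity `hmod`.
[cite: Wuthrich2014, Prop. 21 (p. 400)] [cite: Miller2011LMS, §1 and Def. 1.1] -/
theorem X7.bsdp_of_missingInputAt (hW : sha_dvd_analyticSha)
    (hGZK : rank_eq_analyticRank_of_analyticRank_le_one) (hmod : hasEntireLFunction_rat)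
    (W : WeierstrassCurve ℚ) [W.IsElliptic] [W.IsGloballyMinimal] (p : ℕ) [Fact p.Prime]
    (hr : W.analyticRank ≤ 1) (hX : ClassX7 W p) (hmiss : X7.MissingInputAt W p) : BSDp W p := by
  by_cases hc : W.analyticRank = 0 ∧ p ≠ 2 ∧ (Red W p ∨ Surj W p)
  · obtain ⟨h0, hp, himg⟩ := hc
    have hgood : W.HasGoodReductionAtPrime p := hX.1.1
    have hadd : ¬ ((W.baseChange ℚ_[p]).minimal ℤ_[p]).HasAdditiveReduction ℤ_[p] :=
      WeierstrassCurve.HasGoodReduction.not_hasAdditiveReduction (R := ℤ_[p]) hgood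
    exact bsdp_of_missingLowerBoundAt_of_wuthrich W p hW hGZK hmod hp h0 hadd himg
      (hmiss.1 h0 hp himg)
  · exact bsdp_of_missingPPartAt W p hGZK hr (hmiss.2 hc)

end Literature.NumberTheory.EllipticCurves.Rank1Residual.Typed

/-! ### APPEND (harvest seat 1 GEN 8): at an X7 pair `E[p]` is irreducible for `p ≠ 2`
(Serre 1972 §1.11 Prop. 12, PROVED in the tree) -/

namespace Literature.NumberTheory.EllipticCurves.Rank1Residual

variable (W : WeierstrassCurve ℚ) [W.IsElliptic] [W.IsGloballyMinimal] (p : ℕ) [Fact p.Prime]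

/-- **X7 ⇒ irr(p) at `p ≠ 2`.** At an odd prime of good supersingular reduction `E[p]` is an
irreducible `Γ_ℚ`-module, whatever the reduction elsewhere — Serre, Invent. Math. 15 (1972) §1.11
Prop. 12; tree THEOREM `hasIrreducibleModPGaloisRep_of_dvd_frobeniusTrace` (good: `p ∤ Δ_min`;
supersingular: `p ∣ a_p`). [cite: Serre1972, §1.11 Prop. 12] -/
theorem ClassX7.irr (hp : p ≠ 2) (hX : ClassX7 W p) : Irr W p :=
  hasIrreducibleModPGaloisRep_of_dvd_frobeniusTrace W p hp
    (W.not_dvd_minimalDiscriminantInt_of_hasGoodReductionAtPrime' p hX.1.1) hX.1.2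

/-- Hence an X7 pair with `p ≠ 2` is never Eisenstein: `¬ Red W p`. [cite: Serre1972, §1.11 Prop. 12] -/
theorem ClassX7.not_red (hp : p ≠ 2) (hX : ClassX7 W p) : ¬ Red W p :=
  fun h ↦ h (ClassX7.irr W p hp hX)

end Literature.NumberTheory.EllipticCurves.Rank1Residual

namespace Literature.NumberTheory.EllipticCurves.Rank1Residual.Typed

variable (W : WeierstrassCurve ℚ) [W.IsElliptic] [W.IsGloballyMinimal] (p : ℕ) [Fact p.Prime]

/-- On X7 at `p ≠ 2` the Borel branch of the rank-`0` proviso is empty: `(red(p) ∨ surj(p)) ↔ surj(p)`.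
[cite: Serre1972, §1.11 Prop. 12] -/
theorem X7.red_or_surj_iff (hp : p ≠ 2) (hX : ClassX7 W p) : (Red W p ∨ Surj W p) ↔ Surj W p :=
  ⟨fun h ↦ h.resolve_left (ClassX7.not_red W p hp hX), Or.inr⟩

/-- **X7, analytic rank `0`, odd `p`: the typed missing input with the image dichotomy explicit** —
`surj(p)` ⇒ the signed-IMC lower bound `MissingLowerBoundAt` (Wuthrich's Prop. 21 supplies the upper
half); `¬ surj(p)` (irreducible but proper image; `E` is not semistable, so Serre's Prop. 21 i) does
not apply) ⇒ the whole output `MissingPPartAt`. Bookkeeping equivalence; nothing asserted.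
[cite: Serre1972, §1.11 Prop. 12] [cite: Wuthrich2014, Prop. 21 (p. 400)] [cite: Miller2011LMS, Def. 1.1] -/
theorem X7.missingInputAt_iff_of_analyticRank_eq_zero (hp : p ≠ 2) (hX : ClassX7 W p)
    (h0 : W.analyticRank = 0) :
    X7.MissingInputAt W p ↔
      ((Surj W p → MissingLowerBoundAt W p) ∧ (¬ Surj W p → MissingPPartAt W p)) := by
  have hrs := X7.red_or_surj_iff W p hp hX
  constructor
  · rintro ⟨h1, h2⟩
    exact ⟨fun hs ↦ h1 h0 hp (Or.inr hs), fun hns ↦ h2 (fun hc ↦ hns (hrs.mp hc.2.2))⟩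
  · rintro ⟨h1, h2⟩
    exact ⟨fun _ _ himg ↦ h1 (hrs.mp himg), fun hc ↦ h2 (fun hs ↦ hc ⟨h0, hp, Or.inr hs⟩)⟩

/-- **X7, analytic rank `0`, odd `p`, surjective image: `BSD(E,p)` from the missing signed-IMC lower
bound alone** (Wuthrich's upper bound `hW`; GZK `hGZK`; modularity `hmod`).
[cite: Wuthrich2014, Prop. 21 (p. 400)] [cite: Miller2011LMS, §1 and Def. 1.1] -/
theorem X7.bsdp_of_missingLowerBoundAt_of_surj (hW : sha_dvd_analyticSha)
    (hGZK : rank_eq_analyticRank_of_analyticRank_le_one) (hmod : hasEntireLFunction_rat)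
    (hp : p ≠ 2) (hX : ClassX7 W p) (hs : Surj W p) (h0 : W.analyticRank = 0)
    (hlow : MissingLowerBoundAt W p) : BSDp W p :=
  X7.bsdp_of_missingInputAt hW hGZK hmod W p (by omega) hX
    ((X7.missingInputAt_iff_of_analyticRank_eq_zero W p hp hX h0).mpr
      ⟨fun _ ↦ hlow, fun hns ↦ absurd hs hns⟩)

/-- **X7, analytic rank `0`, odd `p`, NON-surjective image: the typed missing input is the WHOLE
output** (no published upper bound either: Wuthrich's Prop. 21 needs Borel-or-surjective image, and
the image is irreducible by Serre's Prop. 12). Bookkeeping. [cite: Serre1972, §1.11 Prop. 12] [cite: Wuthrich2014, Prop. 21 (p. 400)] [cite: Miller2011LMS, Def. 1.1] -/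
theorem X7.missingInputAt_iff_missingPPartAt_of_not_surj (hp : p ≠ 2) (hX : ClassX7 W p)
    (h0 : W.analyticRank = 0) (hns : ¬ Surj W p) :
    X7.MissingInputAt W p ↔ MissingPPartAt W p := by
  rw [X7.missingInputAt_iff_of_analyticRank_eq_zero W p hp hX h0]
  exact ⟨fun h ↦ h.2 hns, fun h ↦ ⟨fun hs ↦ absurd hs hns, fun _ ↦ h⟩⟩

end Literature.NumberTheory.EllipticCurves.Rank1Residual.Typed
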